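import Literature.ModelTheory.FiniteModelTheory.SparseGraphsFoolCohomology
import HarnessLib

/-!
# Sparse graphs of bounded degree fool cohomological `k`-consistency for `3`-colouring
# (Conneryd–Ghannane–Pang 2025, Theorem 6.1: the order-free deterministic statement)

Topic `Literature/ModelTheory/FiniteModelTheory`.  Bottom-up formalisation of the named fact
`connerydGhannanePang2025_thm_6_1`.  `SparseGraphsFoolCohomology.lean` proves the deterministic
core for a graph that comes with a `χ`-ordering; here we remove that bookkeeping, as in the proof
of Theorem 6.1 ("Let `χ` be a proper coloring of `G`. Order the vertices of `G` by color classes …"):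

* `exists_proper_colouring_of_degree_le` — a finite graph with degrees `≤ d` has a proper
  colouring with `d + 1` colours (greedy; the source uses `χ(G) ≤ d/log d` w.h.p., but any proper
  colouring with `d^{O(1)}`… in fact `O(d)` colours gives the `d^{-O(d)}` form of the theorem);
* `graphCohomologicallyKConsistent_congr_decEq` — the tree notion does not depend on the
  `DecidableEq` instance;
* **`graphCohomologicallyKConsistent_of_sparse_of_degree_le`** — a finite graph with degrees
  `≤ d` (`d ≥ 1`) which is `(ℓ, 1/(4d+10))`-sparse is cohomologically `k`-consistent w.r.t. `K₃`
  for every `k` with `(d+1)·d^d·(k + (3k+1)(2d+5)) ≤ ℓ` (order the vertices by the colour classes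
  of a greedy `(d+1)`-colouring — a `χ`-ordering — and apply `graphCohomologicallyKConsistent_of_sparse`
  with `c = d + 1`, `ε = 1/(4d+10)`).

What remains for the named fact is only the random-graph input of §6 (Lemmas 6.2 and 6.4):
`d`-regular graphs that are `(Ω_d(n), 1/(4d+10))`-sparse with chromatic number `> d/(4 log d)`.

## References

* [ConnerydGhannanePang2025] arXiv:2511.17272, §6, proof of Theorem 6.1. READ.
-/

noncomputable section

namespace Literature.ModelTheory.FiniteModelTheory

namespace ConnerydGhannanePang

open Finset

variable {V : Type*}

/-! ### Greedy colouring -/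

/-- **Greedy colouring**: a finite graph all of whose degrees are `≤ d` has a proper colouring
with `d + 1` colours. [folklore] -/
theorem exists_proper_colouring_of_degree_le [Fintype V] [DecidableEq V] (G : SimpleGraph V)
    [DecidableRel G.Adj] {d : ℕ} (hd : ∀ v, G.degree v ≤ d) :
    ∃ col : V → Fin (d + 1), ∀ u v : V, G.Adj u v → col u ≠ col v := by
  suffices h : ∀ S : Finset V, ∃ col : V → Fin (d + 1), ∀ u ∈ S, ∀ v ∈ S, G.Adj u v → col u ≠ col v by
    obtain ⟨col, hcol⟩ := h Finset.univ
    exact ⟨col, fun u v => hcol u (Finset.mem_univ u) v (Finset.mem_univ v)⟩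
  intro S
  induction S using Finset.induction_on with
  | empty => exact ⟨fun _ => 0, by simp⟩
  | insert a S haS ih =>
    obtain ⟨col, hcol⟩ := ih
    -- a colour not used on the (at most `d`) neighbours of `a`
    obtain ⟨b, hb⟩ : ∃ b : Fin (d + 1), b ∉ (G.neighborFinset a).image col := by
      by_contra! hall
      have hsub : (Finset.univ : Finset (Fin (d + 1))) ⊆ (G.neighborFinset a).image col :=
        fun b _ => hall b
      have h1 := Finset.card_le_card hsub
      have h2 : ((G.neighborFinset a).image col).card ≤ d :=
        Finset.card_image_le.trans (by rw [SimpleGraph.card_neighborFinset_eq_degree]; exact hd a)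
      rw [Finset.card_univ, Fintype.card_fin] at h1
      omega
    refine ⟨Function.update col a b, fun u hu v hv huv => ?_⟩
    rcases Finset.mem_insert.1 hu with rfl | hu
    · have hvu : v ≠ u := (G.ne_of_adj huv).symm
      rw [Function.update_self, Function.update_of_ne hvu]
      intro hbv
      exact hb (Finset.mem_image.2 ⟨v, (G.mem_neighborFinset u v).2 huv, hbv.symm⟩)
    · rcases Finset.mem_insert.1 hv with rfl | hv
      · have huv' : u ≠ v := G.ne_of_adj huv
        rw [Function.update_self, Function.update_of_ne huv']
        intro hcb
        exact hb (Finset.mem_image.2 ⟨u, (G.mem_neighborFinset v u).2 huv.symm, hcb⟩)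
      · have hua : u ≠ a := fun h => haS (h ▸ hu)
        have hva : v ≠ a := fun h => haS (h ▸ hv)
        rw [Function.update_of_ne hua, Function.update_of_ne hva]
        exact hcol u hu v hv huv

/-! ### Independence of the `DecidableEq` instance -/

/-- The tree notion `GraphCohomologicallyKConsistent` does not depend on the decidability
instance used to form contexts. [folklore] -/
theorem graphCohomologicallyKConsistent_congr_decEq {W : Type*} (i₁ i₂ : DecidableEq V) (k : ℕ)
    (G : SimpleGraph V) (H : SimpleGraph W) :
    @GraphCohomologicallyKConsistent V W i₁ k G H ↔ @GraphCohomologicallyKConsistent V W i₂ k G H := by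
  rw [Subsingleton.elim i₁ i₂]

/-- Sparsity does not depend on the decidability instance. [folklore] -/
theorem isSparse_congr_decEq [Fintype V] (i₁ i₂ : DecidableEq V) (G : SimpleGraph V)
    [DecidableRel G.Adj] (s : ℕ) (ε : ℝ) :
    @IsSparse V i₁ G _ _ s ε ↔ @IsSparse V i₂ G _ _ s ε := by
  rw [Subsingleton.elim i₁ i₂]

/-! ### The order-free deterministic theorem -/

/-- **Sparse graphs of bounded degree fool cohomological `k`-consistency for `3`-colourability**
(Conneryd–Ghannane–Pang, Theorem 6.1 without the random graph): a finite graph with all degrees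
`≤ d` (`d ≥ 1`) which is `(ℓ, 1/(4d+10))`-sparse is cohomologically `k`-consistent with respect
to `K₃` for every `k` with `(d+1)·d^d·(k + (3k+1)(2d+5)) ≤ ℓ`.
[cite: ConnerydGhannanePang2025, Thm. 6.1 (proof, §6)] -/
theorem graphCohomologicallyKConsistent_of_sparse_of_degree_le [Fintype V] [DecidableEq V]
    (G : SimpleGraph V) [DecidableRel G.Adj] {d : ℕ} (hd1 : 1 ≤ d) (hd : ∀ v, G.degree v ≤ d)
    {ℓ : ℕ} (hG : IsSparse G ℓ (1 / (4 * d + 10))) {k : ℕ}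
    (hk : (d + 1) * d ^ d * (k + (3 * k + 1) * (2 * d + 5)) ≤ ℓ) :
    GraphCohomologicallyKConsistent k G (⊤ : SimpleGraph (Fin 3)) := by
  classical
  obtain ⟨col, hcol⟩ := exists_proper_colouring_of_degree_le G hd
  -- order the vertices by colour classes (a `χ`-ordering), ties broken by an enumeration
  let e : V ≃ Fin (Fintype.card V) := Fintype.equivFin V
  let f : V → Lex (ℕ × ℕ) := fun v => toLex ((col v : ℕ), (e v : ℕ))
  have hf : Function.Injective f := by
    intro u v h
    have h2 : (e u : ℕ) = e v := congrArg (fun p => (ofLex p).2) h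
    exact e.injective (Fin.ext h2)
  letI : LinearOrder V := LinearOrder.lift' f hf
  have hχ : IsChiOrdering G (fun v => (col v : ℕ)) := by
    refine ⟨fun u v huv h => hcol u v huv (Fin.ext h), fun u v huv => ?_⟩
    have hlt : f u < f v := huv
    rcases Prod.Lex.toLex_lt_toLex.1 hlt with h | ⟨h, -⟩
    · exact le_of_lt h
    · exact le_of_eq h
  have hc : ∀ v, (col v : ℕ) < d + 1 := fun v => (col v).2
  have hε : (0 : ℝ) ≤ 1 / (4 * d + 10) := by positivity
  have hd0 : (0 : ℝ) ≤ d := Nat.cast_nonneg d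
  have hεc : 1 / (4 * (d : ℝ) + 10) * (2 * ((d + 1 : ℕ) : ℝ) + 3) ≤ 1 / 2 := by
    rw [div_mul_eq_mul_div, one_mul, div_le_iff₀ (by positivity)]
    push_cast
    linarith
  have hεd : 1 / (4 * (d : ℝ) + 10) * (d + 1) < 1 / 2 := by
    rw [div_mul_eq_mul_div, one_mul, div_lt_iff₀ (by positivity)]
    linarith
  have hk' : (d + 1) * d ^ (d + 1 - 1) * (k + (3 * k + 1) * (2 * (d + 1) + 3)) ≤ ℓ := by
    rw [Nat.add_sub_cancel]
    have : 2 * (d + 1) + 3 = 2 * d + 5 := by ring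
    rw [this]
    exact hk
  have hc1 : 1 ≤ d + 1 := Nat.le_add_left 1 d
  have h := @graphCohomologicallyKConsistent_of_sparse V _ _ G _ (fun v => (col v : ℕ)) hχ (d + 1) hc hc1 d
    hd1 hd ℓ (1 / (4 * d + 10)) hε hεc hεd ((isSparse_congr_decEq _ _ G ℓ _).1 hG) k hk'
  exact (graphCohomologicallyKConsistent_congr_decEq _ _ k G ⊤).1 h

end ConnerydGhannanePang

end Literature.ModelTheory.FiniteModelTheory
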